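import Literature.InformationTheory.QuantumCodes.ToricCodeCycles
import Literature.InformationTheory.QuantumCodes.ToricCodePolygonExtraction
import Literature.InformationTheory.QuantumCodes.PathCountingBound
import Mathlib.Analysis.SpecificLimits.Basic
import HarnessLib

/-!
# The Dennis–Kitaev–Landahl–Preskill counting-bound threshold for the toric code — proof
# (`ToricCode.failureProb_le_of_sawCountBound` and `ToricCode.toricThreshold_of_sawCountBound` discharged)

Topic `Literature/InformationTheory/QuantumCodes` (venture QEC, LADDER-QEC rung Q5; director-qec
D4″). Theorem-only file assembling

* `PathCountingBound.lean` — the i.i.d. half-weight bound `(2√(p(1-p)))^H` for a fixed set of `H`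
  links and the union bound over a covering family (DKLP eqs. (26)–(28));
* `ToricCodeCycles.lean` — `cycle_weight_ge_holds`: non-trivial cycles have `≥ L` links;
* `ToricCodePolygons.lean` — self-avoiding polygons, their cycle, `n_SAP(H) ≤ L² c_{H-1}`;
* `ToricCodePolygonExtraction.lean` — failure of minimum-weight decoding yields a self-avoiding
  polygon with `H ≥ L` links at least half of which are faulty;

into the two named facts of `ToricCodeThreshold.lean` (qec-type-09):

* **`failureProb_le_of_sawCountBound_holds`** (DKLP eq. (fail_2d) in the tree's constants): for
  `L ≥ 3`, a minimum-weight decoder, `0 ≤ p ≤ 1/2` and `r = 2ν√(p(1-p)) < 1`, under the walk-count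
  bound `cₙ ≤ C νⁿ`:
  `Prob_fail ≤ Σ_{H ≥ L} n_SAP(H) (4p̃)^{H/2} ≤ Σ_{H ≥ L} L² C ν^{H-1} (2√p̃)^H ≤ 2L²C r^L/(ν(1-r))`;
* **`toricThreshold_of_sawCountBound_holds`** (the D4″ parametric threshold theorem): for
  `4ν² p(1-p) < 1` the failure probability of the `(L+1) × (L+1)` toric codes tends to `0`
  (`(L+1)² r^{L+1} → 0`).

No new definitions; no named facts; the printed numerical value `.0373` is not asserted anywhere
(it needs the numerical estimate `μ₂ ≈ 2.638`; certified instances by import live Summits-side).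

## References

* [DennisEtAl2002] E. Dennis, A. Kitaev, A. Landahl, J. Preskill, *Topological quantum memory*,
  J. Math. Phys. 43 (2002) 4452–4505, arXiv:quant-ph/0110143, §5.2 eqs. (26)–(28), §5.3
  eqs. (29), (threshold_2d), (fail_2d).
-/

namespace Literature.InformationTheory.QuantumCodes

namespace ToricCode

open Finset Matrix Filter Topology
open Literature.Probability.RandomPlanarGeometry
open Literature.Probability.RandomPlanarGeometry.SAW.Zd

variable {L : ℕ}

/-- A non-zero element of `ℤ₂` is `1`. [folklore] -/
private theorem zmod2_eq_one_of_ne_zero' {x : ZMod 2} (h : x ≠ 0) : x = 1 := by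
  revert x; decide

/-- A binary chain is determined by its support. [cite: DennisEtAl2002, §4.4 (n_E(ℓ) ∈ {0,1})] -/
private theorem supp_injective [NeZero L] : Function.Injective (supp : Chain L → Finset (Edge L)) := by
  intro e₁ e₂ h
  funext ℓ
  have h1 : ℓ ∈ supp e₁ ↔ ℓ ∈ supp e₂ := by rw [h]
  simp only [supp, Finset.mem_filter, Finset.mem_univ, true_and] at h1
  by_cases h0 : e₁ ℓ = 0
  · rw [h0]
    by_contra h2
    exact (h1.2 (Ne.symm h2)) h0
  · rw [zmod2_eq_one_of_ne_zero' h0, zmod2_eq_one_of_ne_zero' (h1.1 h0)]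

/-- The walk-count hypothesis bounds the number of self-avoiding step words:
`#sawWords 2 n = cₙ ≤ C νⁿ`. [cite: DennisEtAl2002, §5.3 eq. (29)] -/
private theorem card_sawWords_le {C ν : ℝ} (h : SAWCountBound C ν) (n : ℕ) :
    ((Word.sawWords 2 n).card : ℝ) ≤ C * ν ^ n := by
  rw [Word.card_sawWords, SAW.Zd.count_two]
  exact h n

/-- The walk-count constant is at least `1` (`c₀ = 1`), in particular non-negative.
[cite: DennisEtAl2002, §5.3 eq. (29)] -/
private theorem nonneg_of_sawCountBound {C ν : ℝ} (h : SAWCountBound C ν) : 0 ≤ C := by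
  have h0 := h 0
  rw [SAW.count_zero, pow_zero, mul_one, Nat.cast_one] at h0
  linarith

/-- **DKLP's finite-size bound, proved** (given the length bound `cycle_weight_ge` for
non-trivial cycles): `Prob_fail ≤ 2 L² C r^L / (ν (1 - r))`, `r = 2ν√(p(1-p))`.
[cite: DennisEtAl2002, §5.2–5.3 eqs. (28), (29), (fail_2d)] -/
theorem failureProb_le_of_sawCountBound_of (hcw : cycle_weight_ge) : failureProb_le_of_sawCountBound := by
  intro C ν hν hC L hNZ hL D hD p hp0 hp hr1
  classical
  set s := Real.sqrt (p * (1 - p)) with hs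
  set r := 2 * ν * s with hr
  have hs0 : 0 ≤ s := Real.sqrt_nonneg _
  have hr0 : 0 ≤ r := by rw [hr]; positivity
  have h1r : 0 < 1 - r := by linarith
  have hC0 : 0 ≤ C := nonneg_of_sawCountBound hC
  -- Step 1: the failing error chains, reindexed by their supports
  unfold failureProb
  set F := univ.filter (fun e : Chain L => ¬ D.Corrects (syn L) (boundaries L) e) with hF
  have hsum : ∑ e ∈ F, bernoulliWeight p (supp e) = ∑ E ∈ F.image supp, bernoulliWeight p E :=
    (Finset.sum_image fun e₁ _ e₂ _ h => supp_injective h).symm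
  rw [hsum]
  -- Step 2: the covering family of long self-avoiding polygons
  set Ps : Finset (Finset (Edge L)) := univ.filter (fun P =>
    (∃ (v : Vertex L) (w : List (Fin 2 × Bool)), IsPolygon v w ∧ polygonEdges v w = P) ∧ L ≤ P.card)
    with hPs
  have hcover : ∀ E ∈ F.image supp, ∃ P ∈ Ps,
      ((fun P : Finset (Edge L) => P) P).card ≤ 2 * ((fun P : Finset (Edge L) => P) P ∩ E).card := by
    intro E hE
    obtain ⟨e, he, rfl⟩ := Finset.mem_image.1 hE
    have hfail : ¬ D.Corrects (syn L) (boundaries L) e := (Finset.mem_filter.1 he).2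
    obtain ⟨v, w, hP, hLw, hhalf⟩ := exists_polygon_of_failure hL hcw hD hfail
    refine ⟨polygonEdges v w, ?_, ?_⟩
    · rw [hPs, Finset.mem_filter]
      refine ⟨Finset.mem_univ _, ⟨v, w, hP, rfl⟩, ?_⟩
      rw [hP.card_polygonEdges]
      exact hLw
    · simp only
      rw [hP.card_polygonEdges]
      exact hhalf
  have h1 := sum_bernoulliWeight_le_of_cover hp0 hp Ps (fun P : Finset (Edge L) => P) (F.image supp) hcover
  -- Step 3: grade the polygons by their number of links `H ∈ [L, #links]`
  set M := Fintype.card (Edge L) with hM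
  have hmaps : ∀ P ∈ Ps, P.card ∈ Finset.Ico L (M + 1) := by
    intro P hP
    rw [hPs, Finset.mem_filter] at hP
    rw [Finset.mem_Ico]
    exact ⟨hP.2.2, Nat.lt_succ_of_le (Finset.card_le_univ P)⟩
  have h2 : ∑ P ∈ Ps, (2 * s) ^ P.card =
      ∑ H ∈ Finset.Ico L (M + 1), ∑ P ∈ Ps.filter (fun P => P.card = H), (2 * s) ^ P.card :=
    (Finset.sum_fiberwise_of_maps_to hmaps _).symm
  -- Step 4: each fiber has at most `L² c_{H-1} ≤ L² C ν^{H-1}` polygons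
  have hfiber : ∀ H ∈ Finset.Ico L (M + 1),
      ∑ P ∈ Ps.filter (fun P => P.card = H), (2 * s) ^ P.card ≤
        (L : ℝ) ^ 2 * (C * ν ^ (H - 1)) * (2 * s) ^ H := by
    intro H _
    have hcount : ((Ps.filter (fun P => P.card = H)).card : ℝ) ≤ (L : ℝ) ^ 2 * (C * ν ^ (H - 1)) := by
      have hc := card_polygons_le hL H (Ps.filter (fun P => P.card = H)) (by
        intro P hP
        rw [Finset.mem_filter, hPs, Finset.mem_filter] at hP
        obtain ⟨⟨-, ⟨v, w, hPw, rfl⟩, -⟩, hH⟩ := hP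
        exact ⟨v, w, hPw, by rw [← hH, hPw.card_polygonEdges], rfl⟩)
      calc ((Ps.filter (fun P => P.card = H)).card : ℝ)
          ≤ ((L ^ 2 * (Word.sawWords 2 (H - 1)).card : ℕ) : ℝ) := by exact_mod_cast hc
        _ = (L : ℝ) ^ 2 * ((Word.sawWords 2 (H - 1)).card : ℝ) := by push_cast; ring
        _ ≤ (L : ℝ) ^ 2 * (C * ν ^ (H - 1)) :=
            mul_le_mul_of_nonneg_left (card_sawWords_le hC (H - 1)) (by positivity)
    calc ∑ P ∈ Ps.filter (fun P => P.card = H), (2 * s) ^ P.card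
        = ∑ P ∈ Ps.filter (fun P => P.card = H), (2 * s) ^ H :=
          Finset.sum_congr rfl fun P hP => by rw [(Finset.mem_filter.1 hP).2]
      _ = ((Ps.filter (fun P => P.card = H)).card : ℝ) * (2 * s) ^ H := by
          rw [Finset.sum_const, nsmul_eq_mul]
      _ ≤ (L : ℝ) ^ 2 * (C * ν ^ (H - 1)) * (2 * s) ^ H :=
          mul_le_mul_of_nonneg_right hcount (pow_nonneg (by positivity) _)
  -- Step 5: the geometric tail
  have hterm : ∀ H ∈ Finset.Ico L (M + 1),
      (L : ℝ) ^ 2 * (C * ν ^ (H - 1)) * (2 * s) ^ H = (L : ℝ) ^ 2 * C / ν * r ^ H := by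
    intro H hH
    have hH1 : 1 ≤ H := le_trans (by omega : 1 ≤ L) (Finset.mem_Ico.1 hH).1
    obtain ⟨H', rfl⟩ : ∃ H', H = H' + 1 := ⟨H - 1, by omega⟩
    simp only [Nat.add_sub_cancel, hr]
    field_simp
    ring
  have h3 : ∑ H ∈ Finset.Ico L (M + 1), (L : ℝ) ^ 2 * (C * ν ^ (H - 1)) * (2 * s) ^ H =
      (L : ℝ) ^ 2 * C / ν * ∑ H ∈ Finset.Ico L (M + 1), r ^ H := by
    rw [Finset.mul_sum]
    exact Finset.sum_congr rfl hterm
  have hgeom := geom_tail_le hr0 hr1 L (M + 1)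
  calc ∑ E ∈ F.image supp, bernoulliWeight p E
      ≤ ∑ P ∈ Ps, (2 * s) ^ P.card := h1
    _ = ∑ H ∈ Finset.Ico L (M + 1), ∑ P ∈ Ps.filter (fun P => P.card = H), (2 * s) ^ P.card := h2
    _ ≤ ∑ H ∈ Finset.Ico L (M + 1), (L : ℝ) ^ 2 * (C * ν ^ (H - 1)) * (2 * s) ^ H :=
        Finset.sum_le_sum hfiber
    _ = (L : ℝ) ^ 2 * C / ν * ∑ H ∈ Finset.Ico L (M + 1), r ^ H := h3
    _ ≤ (L : ℝ) ^ 2 * C / ν * (r ^ L / (1 - r)) := mul_le_mul_of_nonneg_left hgeom (by positivity)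
    _ ≤ 2 * (L : ℝ) ^ 2 * C * r ^ L / (ν * (1 - r)) := by
        have hX : 0 ≤ (L : ℝ) ^ 2 * C / ν * (r ^ L / (1 - r)) := by positivity
        have hν0 : ν ≠ 0 := hν.ne'
        have h1r0 : 1 - r ≠ 0 := h1r.ne'
        have he : 2 * (L : ℝ) ^ 2 * C * r ^ L / (ν * (1 - r)) =
            2 * ((L : ℝ) ^ 2 * C / ν * (r ^ L / (1 - r))) := by
          field_simp
        rw [he]
        linarith

/-- **The D4″ parametric threshold theorem, proved** (given the finite-size bound): for
`4ν² p(1-p) < 1` the failure probability of minimum-weight decoding of the `(L+1) × (L+1)` toric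
codes tends to `0` ("rapidly approaches zero as `L` gets large").
[cite: DennisEtAl2002, §5.3 eqs. (threshold_2d), (fail_2d)] -/
theorem toricThreshold_of_sawCountBound_of (hfin : failureProb_le_of_sawCountBound) :
    toricThreshold_of_sawCountBound := by
  intro C ν hν hC D hD p hp0 hp h4
  set s := Real.sqrt (p * (1 - p)) with hs
  set r := 2 * ν * s with hr
  have hs0 : 0 ≤ s := Real.sqrt_nonneg _
  have hr0 : 0 ≤ r := by rw [hr]; positivity
  have hpp : 0 ≤ p * (1 - p) := mul_nonneg hp0 (by linarith)
  have hr1 : r < 1 := by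
    have hsq : r ^ 2 = 4 * ν ^ 2 * (p * (1 - p)) := by
      rw [hr, mul_pow, mul_pow, hs, Real.sq_sqrt hpp]
      ring
    have h : r ^ 2 < 1 := by rw [hsq]; exact h4
    have := (sq_lt_one_iff_abs_lt_one r).1 h
    rwa [abs_of_nonneg hr0] at this
  have h1r : 0 < 1 - r := by linarith
  -- the finite-size bound, for `L + 1 ≥ 3`
  have hbound : ∀ L : ℕ, 2 ≤ L →
      failureProb (L + 1) (D L) p ≤ 2 * ((L + 1 : ℕ) : ℝ) ^ 2 * C * r ^ (L + 1) / (ν * (1 - r)) := by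
    intro L hL2
    exact hfin C ν hν hC (L + 1) (by omega) (D L) (hD L) p hp0 hp hr1
  have hnonneg : ∀ L : ℕ, 0 ≤ failureProb (L + 1) (D L) p := by
    intro L
    unfold failureProb
    exact Finset.sum_nonneg fun e _ => bernoulliWeight_nonneg hp0 (by linarith) _
  -- the bound tends to zero: `(L+1)² r^{L+1} → 0`
  have hlim : Tendsto (fun L : ℕ => 2 * ((L + 1 : ℕ) : ℝ) ^ 2 * C * r ^ (L + 1) / (ν * (1 - r)))
      atTop (𝓝 0) := by
    have h0 := tendsto_pow_const_mul_const_pow_of_abs_lt_one 2 (show |r| < 1 by rwa [abs_of_nonneg hr0])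
    have h1 : Tendsto (fun L : ℕ => ((L + 1 : ℕ) : ℝ) ^ 2 * r ^ (L + 1)) atTop (𝓝 0) :=
      (Filter.tendsto_add_atTop_iff_nat 1).2 h0
    have h2 := h1.const_mul (2 * C / (ν * (1 - r)))
    rw [mul_zero] at h2
    refine h2.congr fun L => ?_
    have hν0 : ν ≠ 0 := hν.ne'
    have h1r0 : 1 - r ≠ 0 := h1r.ne'
    field_simp
  refine squeeze_zero' (Filter.Eventually.of_forall hnonneg) ?_ hlim
  rw [Filter.eventually_atTop]
  exact ⟨2, fun L hL => hbound L hL⟩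

/-- **`ToricCode.failureProb_le_of_sawCountBound` holds** — discharges the named fact of
`ToricCodeThreshold.lean`. [cite: DennisEtAl2002, §5.3 eq. (fail_2d)] -/
theorem failureProb_le_of_sawCountBound_holds : failureProb_le_of_sawCountBound :=
  failureProb_le_of_sawCountBound_of cycle_weight_ge_holds

/-- **`ToricCode.toricThreshold_of_sawCountBound` holds** — the Dennis–Kitaev–Landahl–Preskill
threshold for the toric code with minimum-weight decoding and perfect syndrome measurement,
parametric in the self-avoiding-walk count bound (director-qec D4″); discharges the named fact
of `ToricCodeThreshold.lean`. [cite: DennisEtAl2002, §5.2–5.3 eqs. (saw_L), (threshold_2d), (fail_2d)] -/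
theorem toricThreshold_of_sawCountBound_holds : toricThreshold_of_sawCountBound :=
  toricThreshold_of_sawCountBound_of failureProb_le_of_sawCountBound_holds

end ToricCode

end Literature.InformationTheory.QuantumCodes
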